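import Mathlib.GroupTheory.Perm.Basic
import Literature.AnabelianGeometry.SemiGraphs.TemperedPiVirtuallyFreeTower
import Literature.AnabelianGeometry.SemiGraphs.TemperedCoveringsComponents
import Literature.AnabelianGeometry.SemiGraphs.ZariskiMainTheorem
import HarnessLib

/-!
# Non-vacuity of the virtually free tower theorem: the bouquet of two circles

Mochizuki, *Semi-graphs of anabelioids*, Publ. RIMS **42** (2006) [SemiAnbd], §1 p. 16 (the graph
`H_n` "consisting of one vertex `v_H` and `n` edges … (all of which run from `v_H` to `v_H`)"), §3
p. 38 (`π₁^temp(𝒢) := lim_i Gal(𝒢_{∞,i}/𝒢)`, `Gal(𝒢_{∞,i}/𝒢_i) ≅ π₁(𝔾_i)`).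
[cite: MochizukiSemiAnbd2006, Prop 3.6 p.38]

NON-VACUITY CERTIFICATE (abc-iut cell, prover abc-iut-w5-d139; definitions of a MODEL only, no
named facts) for the GENERIC tower theorem `GaloisLevelData.temperedPi_tower_of_exists` of
`TemperedPiVirtuallyFreeTower.lean`: its four hypotheses (fibre-rigid endomorphisms, finite base
fibres, free deck groups of finite rank, a non-abelian deck group at some level) are JOINTLY
SATISFIED by the constant Galois level data (every level the one-sheeted trivial covering) over the
bouquet of two circles `H_2` with TRIVIAL vertex and edge anabelioids; there `Gal(𝒢_{∞,n}/𝒢)` is the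
deck group `π₁(H_2) ≅ F_2` of the universal graph-covering and `π₁^temp(𝒢) = lim_n F_2 = F_2`
(discrete), which indeed has the tower property.  Contents:

* `trivialBouquet` — `H_2` with trivial anabelioids (`ProfiniteSemiGraph`), `trivialBouquetLevels` —
  the constant Galois level data;
* `trivialBouquetLevels_hrigid / _finite / _finite_rank` — the first three hypotheses;
* `loop`, `loops_not_commute` — the loops `b_{i,0}⁻¹ b_{i,1}` of the
  two edges do not commute in `π₁(𝔾_{S n}, [⋆])` (detected in the symmetric group `S_3` through the
  universal property of the free groupoid);
* `temperedPi_tower_trivialBouquet` — the conclusion `htower₀` for this `π₁^temp`, by the generic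
  theorem: its hypothesis set is consistent.

HONEST LABEL: this `𝒢` does NOT satisfy the hypotheses of Prop. 3.6 (trivial vertex groups are not
elevated), so it is NOT a witness for the MODEL theorem `ProfiniteSemiGraph.temperedPi_tower`; a
witness for the latter inside the Prop. 3.6 class (e.g. at the tree's Iwahori loop `loopGraph p`,
`WitnessIwahoriBundle.lean`) needs a Galois level with `b₁ ≥ 2` of the opaque tower `galoisTower` and
is left open.  Nothing here bears on [IUTchIII] Cor. 3.12.
-/

noncomputable section

namespace Literature.AnabelianGeometry.SemiGraphs

namespace ProfiniteSemiGraph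

open CategoryTheory
open _root_.Topology

namespace TrivialBouquet

/-! ### The bouquet of two circles with trivial anabelioids -/

/-- **`H_2` with trivial anabelioids**: one vertex, two loop edges, all constituent groups trivial.
[cite: MochizukiSemiAnbd2006, §1 p.16] -/
abbrev trivialBouquet : ProfiniteSemiGraph.{0} where
  graph := SemiGraph.bouquet.{0} 2
  Gv _ := PUnit
  Ge _ := PUnit
  brHom _ _ _ := ContinuousMonoidHom.id PUnit

/-- `H_2` is countable. [cite: MochizukiSemiAnbd2006, §1 p.11] -/
theorem trivialBouquet_isCountable : trivialBouquet.IsCountable :=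
  ⟨inferInstanceAs (Countable PUnit), inferInstanceAs (Countable (ULift (Fin 2)))⟩

/-- The one-sheeted trivial covering of `H_2` (all fibres `PUnit`). [cite: MochizukiSemiAnbd2006, Def 3.5(i) p.37] -/
abbrev sheet : CovObj trivialBouquet := CovObj.trivialCov trivialBouquet PUnit.{1}

/-- **The constant Galois level data**: every level is the one-sheeted trivial covering, all
transition maps are identities, the base point is the unique point over the vertex.
[cite: MochizukiSemiAnbd2006, Prop 3.6 p.38] -/
abbrev trivialBouquetLevels : GaloisLevelData trivialBouquet where
  S _ := sheet
  g _ := 𝟙 _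
  htrans _ _ _ x' := ⟨𝟙 _, Subsingleton.elim (α := PUnit.{1}) _ x'⟩
  v₀ := PUnit.unit
  x _ := PUnit.unit
  hx _ := rfl

/-! ### The first three hypotheses of the generic tower theorem -/

/-- Endomorphisms of the one-sheeted covering are all equal (rigidity, trivially).
[cite: MochizukiSemiAnbd2006, Def 3.5(iii) p.37] -/
theorem trivialBouquetLevels_hrigid (n : ℕ) (σ σ' : trivialBouquetLevels.S n ⟶ trivialBouquetLevels.S n)
    (_h : (σ.fV trivialBouquetLevels.v₀).hom.hom (trivialBouquetLevels.x n) =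
      (σ'.fV trivialBouquetLevels.v₀).hom.hom (trivialBouquetLevels.x n)) : σ = σ' := by
  refine CovHom.ext (funext fun v => ?_) (funext fun e => ?_)
  · exact Literature.AlgebraicGeometry.Frobenioids.QuasiTemperoid.BTempConnected.hom_ext_apply
      fun x => Subsingleton.elim (α := PUnit.{1}) _ _
  · exact Literature.AlgebraicGeometry.Frobenioids.QuasiTemperoid.BTempConnected.hom_ext_apply
      fun x => Subsingleton.elim (α := PUnit.{1}) _ _

/-- The base fibres are finite. [cite: MochizukiSemiAnbd2006, §3 p.37] -/
theorem trivialBouquetLevels_finite (n : ℕ) :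
    Finite (((trivialBouquetLevels.S n).SV trivialBouquetLevels.v₀).obj.V) :=
  inferInstanceAs (Finite PUnit)

/-- The vertex-orbit `[⋆]` and the edge-orbits `[e]` of the one-sheeted covering: the generating arrow
`b : [e] → [⋆]` of `Cat(𝔾_{S n})` attached to a branch `b` of `e`.
[cite: MochizukiSemiAnbd2006, Def. 2.11 p.32] -/
def brGen (b : (SemiGraph.bouquet.{0} 2).Branch) :
    sheet.orbitGraph.basept (Sum.inr (Quot.mk sheet.ERel ⟨⟨b.down.1⟩, PUnit.unit⟩)) ⟶
      sheet.orbitGraph.basept (sheet.baseComp PUnit.unit PUnit.unit) :=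
  sheet.orbitGraph.brArrow ⟨(b, Quot.mk sheet.ERel ⟨⟨b.down.1⟩, PUnit.unit⟩), rfl⟩ _ _ rfl
    (sheet.orbitGraph_abuts_mk b PUnit.unit rfl ⟨_, rfl⟩ PUnit.unit rfl)

/-- Every component of `𝔾_{S n}` is reachable from the base component `[⋆]`.
[cite: MochizukiSemiAnbd2006, §1 p.14] -/
theorem nonempty_hom_baseComp (a : sheet.orbitGraph.CatCarrier) :
    Nonempty (sheet.orbitGraph.basept (sheet.baseComp PUnit.unit PUnit.unit) ⟶
      sheet.orbitGraph.basept a) := by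
  rcases a with V | E
  · induction V using Quot.ind with
    | mk q =>
      obtain ⟨v, x⟩ := q
      obtain rfl : v = PUnit.unit := rfl
      obtain rfl : x = PUnit.unit := rfl
      exact ⟨𝟙 _⟩
  · induction E using Quot.ind with
    | mk q =>
      obtain ⟨⟨i⟩, y⟩ := q
      obtain rfl : y = PUnit.unit := rfl
      exact ⟨inv (brGen ⟨(i, false)⟩)⟩

/-- **The deck groups `π₁(𝔾_{S n}, [⋆])` are free of finite rank.** [cite: MochizukiSemiAnbd2006, §1 p.20] -/
theorem trivialBouquetLevels_finite_rank (n : ℕ) :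
    ∃ _ : IsFreeGroup ((trivialBouquetLevels.S n).orbitGraph.FundamentalGroup
        ((trivialBouquetLevels.S n).baseComp trivialBouquetLevels.v₀ (trivialBouquetLevels.x n))),
      Finite (IsFreeGroup.Generators ((trivialBouquetLevels.S n).orbitGraph.FundamentalGroup
        ((trivialBouquetLevels.S n).baseComp trivialBouquetLevels.v₀ (trivialBouquetLevels.x n)))) := by
  haveI : Finite trivialBouquet.graph.Edge := inferInstanceAs (Finite (ULift (Fin 2)))
  haveI : Finite (trivialBouquetLevels.S n).orbitGraph.Branch :=
    CovObj.finite_orbitGraph_branch _ (CovObj.trivialCov_punit_isFinite trivialBouquet)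
  exact Literature.GroupTheory.CombinatorialGroupTheory.SemiGraph.exists_isFreeGroup_finite_generators_fundamentalGroup
    _ _ nonempty_hom_baseComp

/-! ### The fourth hypothesis: two non-commuting loops -/

/-- The loop `b_{i,0}⁻¹ · b_{i,1}` of the `i`-th edge at the base component (an element of
`π₁(𝔾_{S n}, [⋆]) = π₁(H_2, v_H)`). [cite: MochizukiSemiAnbd2006, §1 p.16] -/
def loop (i : Fin 2) :
    sheet.orbitGraph.FundamentalGroup (sheet.baseComp PUnit.unit PUnit.unit) :=
  Groupoid.inv (brGen ⟨(i, false)⟩) ≫ brGen ⟨(i, true)⟩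

/-- The labelling detecting non-commutativity: the branch `(i, true)` is sent to a transposition of
`S_3` (`(0 1)` for `i = 0`, `(1 2)` for `i = 1`), the branches `(i, false)` to `1`.
[cite: MochizukiSemiAnbd2006, §1 p.16] -/
def label (b : (SemiGraph.bouquet.{0} 2).Branch) : Equiv.Perm (Fin 3) :=
  if b.down.2 then (if b.down.1 = 0 then Equiv.swap 0 1 else Equiv.swap 1 2) else 1

/-- The labelling as a prefunctor `Cat(𝔾_{S n}) ⥤q S_3` (one object). [cite: MochizukiSemiAnbd2006, Def. 2.11 p.32] -/
def labelPrefunctor : sheet.orbitGraph.CatCarrier ⥤q CategoryTheory.SingleObj (Equiv.Perm (Fin 3)) where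
  obj _ := CategoryTheory.SingleObj.star _
  map {x y} a := match x, y, a with
    | Sum.inr _, Sum.inl _, a => label a.1.1.1
    | Sum.inl _, Sum.inl _, a => PEmpty.elim a
    | Sum.inl _, Sum.inr _, a => PEmpty.elim a
    | Sum.inr _, Sum.inr _, a => PEmpty.elim a

/-- The functor `Φ : Π₁(𝔾_{S n}) ⥤ S_3` induced by the labelling (universal property of the free
groupoid). [cite: MochizukiSemiAnbd2006, §1 p.14] -/
def labelFunctor : sheet.orbitGraph.FundamentalGroupoid ⥤ CategoryTheory.SingleObj (Equiv.Perm (Fin 3)) :=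
  Quiver.FreeGroupoid.lift labelPrefunctor

/-- `Φ` on a generating arrow is its label. [cite: MochizukiSemiAnbd2006, §1 p.14] -/
theorem labelFunctor_map_of {x y : sheet.orbitGraph.CatCarrier} (a : x ⟶ y) :
    labelFunctor.map ((Quiver.FreeGroupoid.of _).map a) = labelPrefunctor.map a := by
  change (Paths.lift (Quiver.Symmetrify.lift labelPrefunctor)).map (Quiver.Hom.toPos a).toPath = _
  rw [Paths.lift_toPath]
  rfl

/-- `Φ(b_{i,c}) = label (i, c)`. [cite: MochizukiSemiAnbd2006, §1 p.16] -/
theorem labelFunctor_map_brGen (b : (SemiGraph.bouquet.{0} 2).Branch) :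
    labelFunctor.map (brGen b) = label b :=
  labelFunctor_map_of _

/-- `Φ` turns groupoid inverses into group inverses. [cite: MochizukiSemiAnbd2006, §1 p.14] -/
theorem labelFunctor_map_groupoidInv {x y : sheet.orbitGraph.FundamentalGroupoid} (f : x ⟶ y) :
    labelFunctor.map (Groupoid.inv f) = Groupoid.inv (labelFunctor.map f) := by
  rw [Groupoid.inv_eq_inv, Groupoid.inv_eq_inv, Functor.map_inv]

/-- `Φ(loop i)` is the transposition labelling `(i, true)`. [cite: MochizukiSemiAnbd2006, §1 p.16] -/
theorem labelFunctor_map_loop (i : Fin 2) :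
    labelFunctor.map (loop i) = (if i = 0 then Equiv.swap 0 1 else Equiv.swap 1 2 : Equiv.Perm (Fin 3)) := by
  rw [loop, Functor.map_comp, SingleObj.comp_as_mul, labelFunctor_map_groupoidInv,
    labelFunctor_map_brGen, labelFunctor_map_brGen]
  change label ⟨(i, true)⟩ * (label ⟨(i, false)⟩)⁻¹ = _
  simp [label]

/-- **The two loops do not commute** in `π₁(𝔾_{S n}, [⋆])` (their images `(0 1)`, `(1 2)` in `S_3`
do not). [cite: MochizukiSemiAnbd2006, §1 p.16] -/
theorem loops_not_commute : loop 0 * loop 1 ≠ loop 1 * loop 0 := by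
  intro h
  have h' := congrArg labelFunctor.map h
  change labelFunctor.map (loop 0 ≫ loop 1) = labelFunctor.map (loop 1 ≫ loop 0) at h'
  rw [Functor.map_comp, Functor.map_comp, labelFunctor_map_loop, labelFunctor_map_loop,
    SingleObj.comp_as_mul, SingleObj.comp_as_mul] at h'
  exact absurd (Equiv.congr_fun h' 0) (by decide)

/-! ### The conclusion -/

/-- **The hypothesis set of `GaloisLevelData.temperedPi_tower_of_exists` is consistent**, and the
tempered fundamental group `π₁^temp = lim_n π₁(H_2) (= F_2)` of the bouquet of two circles with
trivial anabelioids has the virtually free tower property `htower₀`.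
[cite: MochizukiSemiAnbd2006, Prop 3.6 p.38] -/
theorem temperedPi_tower_trivialBouquet :
    ∀ U ∈ 𝓝 (1 : trivialBouquetLevels.temperedPi trivialBouquet_isCountable),
      ∃ N : OpenNormalSubgroup (trivialBouquetLevels.temperedPi trivialBouquet_isCountable),
      (N : Set (trivialBouquetLevels.temperedPi trivialBouquet_isCountable)) ⊆ U ∧
      ∃ (G : Subgroup (trivialBouquetLevels.temperedPi trivialBouquet_isCountable ⧸ N.toSubgroup))
        (_ : IsFreeGroup G), G.Normal ∧ G.FiniteIndex ∧ Finite (IsFreeGroup.Generators G) ∧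
        ∃ a ∈ G, ∃ b ∈ G, a * b ≠ b * a :=
  trivialBouquetLevels.temperedPi_tower_of_exists trivialBouquet_isCountable
    trivialBouquetLevels_hrigid trivialBouquetLevels_finite trivialBouquetLevels_finite_rank
    ⟨0, loop 0, loop 1, loops_not_commute⟩

end TrivialBouquet

end ProfiniteSemiGraph

end Literature.AnabelianGeometry.SemiGraphs

end
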